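import Summits.BirchSwinnertonDyer.BirchSwinnertonDyer.Theorems.KatoDescentPotSupersingularMemberHullCoreInputsOfFine
import Summits.BirchSwinnertonDyer.BirchSwinnertonDyer.Theorems.KatoDescentPotSupersingularTowerTorsionFinite
import HarnessLib

/-!
# 27962 (`Kato2004.exists_memberHullZetaCoreInputs`), THE O6 NODE BEHIND CRUX M AND U₀-red FROM {Fine, H2X⁺, Lim, FW} WITH THE
# IMAI SCHEMA HALVED TO THE POTENTIALLY ORDINARY ROWS (route-free helper for crux M = stmt-BirchSwinnertonDyer-19196
# `ReducibleKatoMember`, K9 / K8-t′; seat `bsd-potss-rkm` g31)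

Seat g30's `CoreInputsOfFine.exists_memberHullZetaCoreInputs_of_fineInputs` (p677595) rebuilt the held core package of crux M
from {`exists_memberHullZetaFineInputs`, H2X⁺, Lim 3.5, Ferrero–Washington} and a DISPLAYED Imai schema `hImai` (the finiteness
of `W(ℚ_{p,∞})[p^∞]` for EVERY `W/ℚ` with `0 ≤ ord_p j`).  On the potentially SUPERSINGULAR rows that finiteness is now a TREE
THEOREM (`TowerTorsionFinite.finite_fixedPoints_kerSubgroup_inf_decomp_of_potentiallySupersingular`, this seat, p680430: Serre
1967 §5 Prop. 8 proved by cell `bsd-wall`).  THIS FILE re-issues the three ∀-level theorems of p677595 with the schema demanded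
ONLY on the potentially ORDINARY rows (`hImaiOrd`: curves with a unit root at SOME place of good reduction above `p` of SOME
number field): at Kato's member `W'` the proof branches — no such place ⟹ the tree theorem at `W'`; otherwise `hImaiOrd`.
Neither route of the cell meets a potentially ordinary row (K9: `ClassO6`; K8-t′: census cell (t′)); the per-row, Imai-FREE
closers on those rows are in the sibling file `…ReducibleKatoMemberOfFineInputsPotSupersingular` (this seat).

HONEST FRAMING.  Theorems only (no definition, no named fact, no `sorry`); route-free; closes nothing by itself; the conclusions
are CONDITIONAL on the displayed named facts (the audit records `proof.conditional` for the O6 node); BSD is proved for no curve;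
nothing is booked.  The potentially ordinary half of Imai (unit-root argument, Greenberg LNM 1716 §2 p. 70) is NOT proved here.

References: [Kato2004Asterisque] Thm. 12.5 (pp. 221–222), Cor. 14.3 / Thm. 14.5 (pp. 235–236), (14.9.1)–(14.9.3) (pp. 239–240),
§14.14 (p. 243), Prop. 14.16 (2) (pp. 244–245); [Imai1975] Theorem (p. 12); [Serre1967GroupesPDivisibles] §5 Prop. 8;
[Wuthrich2014] Lemma 14 (p. 396); [GreenbergLNM1716] §2 p. 70, §3 Lemma 3.3; tree: `…MemberHullCoreInputsOfFine{,Named}` (rkm g30),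
`…TowerTorsionFinite` (rkm g31), `…ReducibleUpperOfCoreInputs` / `…ZetaLineRankZero` (rkm g25).
-/

-- the summit and its single problem are both named `BirchSwinnertonDyer` (registry layout D-0017)
set_option linter.dupNamespace false
set_option autoImplicit false

noncomputable section

open scoped Classical NumberField TensorProduct
open Function Field NumberField IsDedekindDomain WeierstrassCurve CongruenceSubgroup
open Literature.NumberTheory.EllipticCurves Literature.NumberTheory.EllipticCurves.GreenbergSelmer
open Literature.NumberTheory.GaloisRepresentations Literature.NumberTheory.GaloisCohomology
open Literature.NumberTheory.EllipticCurves.ModularForms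
open Literature.NumberTheory.EllipticCurves.Kato2004 Literature.NumberTheory.EllipticCurves.Kato2004.EulerSystemValues
open Literature.NumberTheory.EllipticCurves.IwasawaAlgebra Literature.NumberTheory.EllipticCurves.IwasawaDual
open Literature.NumberTheory.EllipticCurves.Rank1Residual Literature.NumberTheory.EllipticCurves.Rank1Residual.Typed
open Summit.BirchSwinnertonDyer.Rank1Residual Summit.BirchSwinnertonDyer.Rank1Residual.Additive
open Summit.BirchSwinnertonDyer.BirchSwinnertonDyer.Theorems
open Summit.BirchSwinnertonDyer.BirchSwinnertonDyer.Theorems.IntegralH1LayerZeroTop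

universe u

namespace Summit.BirchSwinnertonDyer.BirchSwinnertonDyer.Theorems.FineInputsImaiOrd

/-! ## 27962, the O6 node and U₀-red with the Imai schema HALVED to the potentially ORDINARY rows -/

/-- **`exists_memberHullZetaFineInputs → H2X⁺ → Lim 3.5 → FW → (Imai on the potentially ORDINARY rows only) → exists_memberHullZetaCoreInputs`.**
As `CoreInputsOfFine.exists_memberHullZetaCoreInputs_of_fineInputs` (p677595), but the displayed Imai schema is now demanded ONLY
for curves with a unit root at SOME place of good reduction above `p` of SOME number field (potentially ordinary reduction): at
Kato's member `W'` either no such place exists — then the finiteness is the tree theorem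
`TowerTorsionFinite.finite_fixedPoints_kerSubgroup_inf_decomp_of_potentiallySupersingular` at `W'` — or `hImaiOrd` applies.
Neither route of the cell (K9: `ClassO6`; K8-t′: (t′)) meets a potentially ordinary row.
[cite: Kato2004Asterisque, Thm. 12.5 (1)–(3) (pp. 221–222), Cor. 14.3 and Thm. 14.5 (pp. 235–236), (14.9.1) (p. 239), (14.9.3) (p. 240), §14.14 (p. 243), Prop. 14.16 (2) (pp. 244–245)]
[cite: Imai1975, Theorem (p. 12)] [cite: Serre1967GroupesPDivisibles, §5 Prop. 8] [cite: Wuthrich2014, Lemma 14 (p. 396)] -/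
theorem exists_memberHullZetaCoreInputs_of_fineInputs_of_imaiOrd (hF : exists_memberHullZetaFineInputs)
    (hH : exists_iwasawaH2Data_fineSelmerDual_embedding_count)
    (hLim : Lim2017.thm35_fineSelmerDual_moduleFinite_of_classicalMuVanishes_of_le_divisionField)
    (hFW : Literature.NumberTheory.IwasawaTheory.ferreroWashington1979_classicalMuVanishes)
    (hImaiOrd : ∀ (W : WeierstrassCurve ℚ) [W.IsElliptic] (p : ℕ) [Fact p.Prime] (κ : ZpExtension ℚ p)
      (v : HeightOneSpectrum (𝓞 ℚ)), 0 ≤ padicValRat p W.j →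
      (∃ (F : Type) (_ : Field F) (_ : NumberField F) (w : HeightOneSpectrum (𝓞 F)),
        ((p : ℕ) : 𝓞 F) ∈ w.asIdeal ∧ (W.baseChange F).HasGoodReductionAt w ∧ (W.baseChange F).HasUnitRootAt w) →
      κ.IsCyclotomic → ((Rat.HeightOneSpectrum.primesEquiv v : Nat.Primes) : ℕ) = p →
      Finite (FixedPoints.addSubgroup ↥(κ.kerSubgroup ⊓ GreenbergSelmer.decomp v) (W.geomPrimaryTorsion p))) :
    exists_memberHullZetaCoreInputs := by
  intro W _ _ p _ hp hgood hmult hj hirr hL hsha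
  have hpp : p.Prime := Fact.out
  have hPT : poitouTate_selmerStructure_duality ℚ :=
    poitouTate_selmerStructure_duality_of_conj (InputsPoitouTateSelmer.poitouTate_selmerStructure_duality_conj_holds ℚ)
  obtain ⟨W', hW'e, hW'm, hiso, hrest⟩ := hF W p hp hgood hmult hj hirr hL hsha
  haveI := hW'e
  haveI := hW'm
  -- transports along the isogeny `W ∼ W'`
  have hirr' : ¬ W'.HasIrreducibleModPGaloisRep p := Rank1Residual.not_hasIrreducibleModPGaloisRep_of_isIsogenous hiso hirr
  obtain ⟨φ⟩ := hiso
  have hj' : 0 ≤ padicValRat p W'.j := padicValRat_j_nonneg_of_isogeny φ hpp hj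
  have hshaW' : W'.ShaFinite := (show IsIsogenous W W' from ⟨φ⟩).shaFinite_iff_shaFinite.mp hsha
  haveI : Finite W'.sha := hshaW'
  refine ⟨W', hW'e, hW'm, ⟨φ⟩, ?_⟩
  intro _ _ _ N _ f hf ι
  obtain ⟨κ', Λ', c, d, a, A, z, x, hκ', hA, hc, hd, hZB, hall⟩ := hrest f hf ι
  refine ⟨κ', Λ', c, d, a, A, z, x, hκ', hA, hc, hd, hZB, ?_⟩
  intro κ γ hκ hγ I y hy
  obtain ⟨Z⟩ := hall κ γ hκ hγ I y hy
  -- the place of `ℚ` at `p` and the finiteness at the member: the tree on the potentially supersingular branch, `hImaiOrd` else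
  let v : HeightOneSpectrum (𝓞 ℚ) := Rat.HeightOneSpectrum.primesEquiv.symm ⟨p, hpp⟩
  have hv : ((Rat.HeightOneSpectrum.primesEquiv v : Nat.Primes) : ℕ) = p := by
    simp only [v, Equiv.apply_symm_apply]
  have hfin : Finite (FixedPoints.addSubgroup ↥(κ.kerSubgroup ⊓ decomp v) (W'.geomPrimaryTorsion p)) := by
    by_cases hss : ∀ (F : Type) [Field F] [NumberField F] (w : HeightOneSpectrum (𝓞 F)),
        ((p : ℕ) : 𝓞 F) ∈ w.asIdeal → (W'.baseChange F).HasGoodReductionAt w → ¬ (W'.baseChange F).HasUnitRootAt w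
    · exact TowerTorsionFinite.finite_fixedPoints_kerSubgroup_inf_decomp_of_potentiallySupersingular W' p hp hj' hss κ v hv
    · push Not at hss
      obtain ⟨F, _, _, w, hw, hgoodw, hunit⟩ := hss
      exact hImaiOrd W' p κ v hj' ⟨F, inferInstance, inferInstance, w, hw, hgoodw, hunit⟩ hκ hv
  -- `W'(ℚ)` finite from clause (b′) of the package; `Ш(W')[p^∞]` finite from `Ш(W)` finite
  haveI : Finite W'.toAffine.Point := by
    obtain ⟨q, -, e, -, hZL⟩ := Z.zetaLineIndex
    exact ZetaLineRankZero.finite_point_of_zetaLineOrthIndexAt W' p hPT hp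
      (layerZeroToTop_mem_integralH1 W' p κ (I.proj_mem 0 y)) hZL
  haveI : Finite (AddCommGroup.primaryComponent W'.sha p) := inferInstance
  -- H2X⁺ at the member, and the assembly of the core package
  obtain ⟨J, eX, heX, hcokX, hc⟩ := hH W' p κ γ hγ v hp hκ hv hfin I
  exact CoreInputsOfFine.nonempty_coreInputs_of_fineInputs W' p hLim hFW hp hκ hγ hirr' Z J eX heX hcokX
    (hc inferInstance inferInstance)

/-- **THE O6 NODE BEHIND CRUX M (`O6.KatoMemberShaBoundOfReducible`) from modularity, Fine, H2X⁺, Lim, FW and Imai's finiteness on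
the potentially ORDINARY rows ONLY.** [cite: Kato2004Asterisque, Thm. 12.6 (p. 222), Prop. 14.16 (2) (pp. 244–245)]
[cite: Imai1975, Theorem (p. 12)] [cite: Serre1967GroupesPDivisibles, §5 Prop. 8] -/
theorem katoMemberShaBoundOfReducible_of_newform_of_fineInputs_of_imaiOrd (hmod : exists_isNewformOf)
    (hF : exists_memberHullZetaFineInputs) (hH : exists_iwasawaH2Data_fineSelmerDual_embedding_count)
    (hLim : Lim2017.thm35_fineSelmerDual_moduleFinite_of_classicalMuVanishes_of_le_divisionField)
    (hFW : Literature.NumberTheory.IwasawaTheory.ferreroWashington1979_classicalMuVanishes)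
    (hImaiOrd : ∀ (W : WeierstrassCurve ℚ) [W.IsElliptic] (p : ℕ) [Fact p.Prime] (κ : ZpExtension ℚ p)
      (v : HeightOneSpectrum (𝓞 ℚ)), 0 ≤ padicValRat p W.j →
      (∃ (F : Type) (_ : Field F) (_ : NumberField F) (w : HeightOneSpectrum (𝓞 F)),
        ((p : ℕ) : 𝓞 F) ∈ w.asIdeal ∧ (W.baseChange F).HasGoodReductionAt w ∧ (W.baseChange F).HasUnitRootAt w) →
      κ.IsCyclotomic → ((Rat.HeightOneSpectrum.primesEquiv v : Nat.Primes) : ℕ) = p →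
      Finite (FixedPoints.addSubgroup ↥(κ.kerSubgroup ⊓ GreenbergSelmer.decomp v) (W.geomPrimaryTorsion p))) :
    Rank1Residual.O6.KatoMemberShaBoundOfReducible :=
  ZetaLineRankZero.katoMemberShaBoundOfReducible_of_newform_of_coreInputs hmod
    (exists_memberHullZetaCoreInputs_of_fineInputs_of_imaiOrd hF hH hLim hFW hImaiOrd)

/-- **U₀-red's reducible upper half (`MissingUpperBoundAt` at `r_an = 0`) from the same atoms with Imai's finiteness on the
potentially ORDINARY rows ONLY** (U₀-red's other held inputs displayed as in the prequel).
[cite: Kato2004Asterisque, §14.14 (p. 243), proof of Prop. 14.16 (pp. 244–245)] [cite: Imai1975, Theorem (p. 12)] -/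
theorem missingUpperBoundAt_of_fineInputs_of_imaiOrd (hne : Kato2004.nonempty_iwasawaH1Data) (hmod : exists_isNewformOf)
    (hF : exists_memberHullZetaFineInputs) (hH : exists_iwasawaH2Data_fineSelmerDual_embedding_count)
    (hLim : Lim2017.thm35_fineSelmerDual_moduleFinite_of_classicalMuVanishes_of_le_divisionField)
    (hFW : Literature.NumberTheory.IwasawaTheory.ferreroWashington1979_classicalMuVanishes)
    (hImaiOrd : ∀ (W : WeierstrassCurve ℚ) [W.IsElliptic] (p : ℕ) [Fact p.Prime] (κ : ZpExtension ℚ p)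
      (v : HeightOneSpectrum (𝓞 ℚ)), 0 ≤ padicValRat p W.j →
      (∃ (F : Type) (_ : Field F) (_ : NumberField F) (w : HeightOneSpectrum (𝓞 F)),
        ((p : ℕ) : 𝓞 F) ∈ w.asIdeal ∧ (W.baseChange F).HasGoodReductionAt w ∧ (W.baseChange F).HasUnitRootAt w) →
      κ.IsCyclotomic → ((Rat.HeightOneSpectrum.primesEquiv v : Nat.Primes) : ℕ) = p →
      Finite (FixedPoints.addSubgroup ↥(κ.kerSubgroup ⊓ GreenbergSelmer.decomp v) (W.geomPrimaryTorsion p)))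
    (hCassels : bsdRHS_eq_of_isIsogenous) (hGZK : rank_eq_analyticRank_of_analyticRank_le_one)
    (hmodL : hasEntireLFunction_rat)
    (W : WeierstrassCurve ℚ) [W.IsElliptic] [W.IsGloballyMinimal] (p : ℕ) [Fact p.Prime]
    (hp : p ≠ 2) (hng : ¬ W.HasGoodReductionAtPrime p) (hnm : ¬ W.HasMultiplicativeReductionAtPrime p)
    (hj : 0 ≤ padicValRat p W.j) (hred : ¬ W.HasIrreducibleModPGaloisRep p)
    (hr : W.analyticRank = 0) : MissingUpperBoundAt W p :=
  ReducibleUpperOfCoreInputs.missingUpperBoundAt_of_coreInputs' hne hmod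
    (exists_memberHullZetaCoreInputs_of_fineInputs_of_imaiOrd hF hH hLim hFW hImaiOrd) hCassels hGZK hmodL
    W p hp hng hnm hj hred hr

end Summit.BirchSwinnertonDyer.BirchSwinnertonDyer.Theorems.FineInputsImaiOrd

end
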